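import Summits.QuantumFields.YangMills.Theses.ConvexGribovBody
import Literature.MathematicalPhysics.QuantumFieldTheory.LatticeGaugeProofs
import Literature.MathematicalPhysics.QuantumLattice.LatticeGaugeDLRFreeEnergyProofs
import Summits.QuantumFields.YangMills.Theorems.ConvexGribovBodyBrascampLiebVacuumStubTransport

/-!
# The `(2,3)`-plaquette species is an admissible layer observable
(crux `ConvexGribovBody.PoincareToGap`, line `Sketch`, stub G3)

Torus `(ℤ/(2S+1))⁴`, `S ≥ 1`, a unitary lattice representation `r` (`r.ρ g ∈ U(N)`).  The torus
reading of the `(2,3)`-plaquette species at the origin,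
`P U := plaquetteObs r.ρ 0 2 3 (torusLift (2S+1) U) = Re tr r.ρ (U(0,2) U(e₂,3) U(e₃,2)⁻¹ U(0,3)⁻¹)`
(bridge `FreeEnergy.plaquetteHolonomyZd_torusLift`), satisfies:
* (a) `P` is gauge invariant (the holonomy is conjugated by `g 0`, the trace is cyclic);
* (b) `P` reads only the four plaquette links, which lie in the layer `{t = 0, x₁ = 0}` and point
  in the directions `2, 3`;
* (c) `|P U − P V| ≤ √N Σ_e ‖r.ρ (U e) − r.ρ (V e)‖_F` (Frobenius norm): left/right multiplication
  by a unitary is a Frobenius isometry (so replacing one unitary factor of a word costs exactly the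
  Frobenius distance of the factors; Minkowski for the entrywise `ℓ²` norm), inverses cost the same
  (`ρ(x⁻¹) − ρ(y⁻¹) = ρ(x⁻¹) (ρ y − ρ x) ρ(y⁻¹)`), `|Re tr M| ≤ √N ‖M‖_F` (Cauchy–Schwarz on the
  diagonal), and the four links are pairwise distinct because `2S+1 ≥ 3`;
* (d) for every probability measure `μ` the time-zero Dirichlet form is `≤ 4N`: by (c) for a
  one-link update the metric difference quotient is `≤ √N`, so its `limsup` over `𝓝[≠] (U e)` lies
  in `[0, √N]` (junk value `0` when that filter is `⊥`); by (b) it vanishes off the four links.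

References: folklore (K. Wilson, Phys. Rev. D 10 (1974) 2445; E. Seiler, LNP 159 (1982), Ch. 1).
-/

noncomputable section

open scoped BigOperators Topology Matrix
open MeasureTheory Filter
open Literature.MathematicalPhysics.QuantumFieldTheory Literature.MathematicalPhysics.QuantumLattice

namespace Summit.QuantumFields.YangMills.Theorems.PoincareToGap

open Summit.QuantumFields.YangMills.Theorems.BrascampLiebVacuum (fro_eq_re_trace
  fro_mul_of_mem_unitaryGroup)

/-! ### Frobenius bookkeeping for unitary matrices -/

section Frobenius

variable {N : ℕ}

/-- Cauchy–Schwarz on the diagonal: `|Re tr M| ≤ √N ‖M‖_F`. [folklore] -/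
private theorem abs_re_trace_le_sqrt (M : Matrix (Fin N) (Fin N) ℂ) :
    |M.trace.re| ≤ Real.sqrt N * Real.sqrt (∑ a, ∑ b, ‖M a b‖ ^ 2) := by
  have h1 : |M.trace.re| ≤ ∑ a, ‖M a a‖ := by
    rw [Matrix.trace, Complex.re_sum]
    exact (Finset.abs_sum_le_sum_abs _ _).trans
      (Finset.sum_le_sum fun a _ => Complex.abs_re_le_norm _)
  have h2 : (∑ a, ‖M a a‖) ^ 2 ≤ N * ∑ a, ∑ b, ‖M a b‖ ^ 2 := by
    calc (∑ a, ‖M a a‖) ^ 2 ≤ (Finset.univ : Finset (Fin N)).card * ∑ a, ‖M a a‖ ^ 2 :=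
          sq_sum_le_card_mul_sum_sq
      _ = N * ∑ a, ‖M a a‖ ^ 2 := by rw [Finset.card_univ, Fintype.card_fin]
      _ ≤ N * ∑ a, ∑ b, ‖M a b‖ ^ 2 := by
          gcongr with a
          exact Finset.single_le_sum (f := fun b => ‖M a b‖ ^ 2) (fun b _ => sq_nonneg _)
            (Finset.mem_univ a)
  rw [← Real.sqrt_mul (Nat.cast_nonneg _)]
  exact h1.trans (Real.le_sqrt_of_sq_le h2)

/-- Left unitary invariance of the Frobenius form: `‖u M‖_F = ‖M‖_F` for unitary `u`.
[folklore] -/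
private theorem fro_unitary_mul (M : Matrix (Fin N) (Fin N) ℂ) {u : Matrix (Fin N) (Fin N) ℂ}
    (hu : u ∈ Matrix.unitaryGroup (Fin N) ℂ) :
    ∑ a, ∑ b, ‖(u * M) a b‖ ^ 2 = ∑ a, ∑ b, ‖M a b‖ ^ 2 := by
  have hu' : uᴴ * u = 1 := by
    rw [← Matrix.star_eq_conjTranspose]; exact Matrix.mem_unitaryGroup_iff'.1 hu
  rw [fro_eq_re_trace, fro_eq_re_trace, Matrix.conjTranspose_mul, Matrix.mul_assoc,
    Matrix.trace_mul_comm u, Matrix.mul_assoc, Matrix.mul_assoc, hu', Matrix.mul_one]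

/-- The Frobenius form of a difference is symmetric. [folklore] -/
private theorem fro_sub_comm (A B : Matrix (Fin N) (Fin N) ℂ) :
    ∑ a, ∑ b, ‖(A - B) a b‖ ^ 2 = ∑ a, ∑ b, ‖(B - A) a b‖ ^ 2 := by
  refine Finset.sum_congr rfl fun a _ => Finset.sum_congr rfl fun b _ => ?_
  rw [Matrix.sub_apply, Matrix.sub_apply, norm_sub_rev]

/-- Cauchy–Schwarz for the Frobenius pairing: `Σ_{ab} ‖A_ab‖ ‖B_ab‖ ≤ ‖A‖_F ‖B‖_F` (row by row,
then over the rows). [folklore] -/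
private theorem sum_norm_mul_norm_le (A B : Matrix (Fin N) (Fin N) ℂ) :
    ∑ a, ∑ b, ‖A a b‖ * ‖B a b‖ ≤
      Real.sqrt (∑ a, ∑ b, ‖A a b‖ ^ 2) * Real.sqrt (∑ a, ∑ b, ‖B a b‖ ^ 2) :=
  (Finset.sum_le_sum fun _ _ => Real.sum_mul_le_sqrt_mul_sqrt _ _ _).trans
    (Real.sum_sqrt_mul_sqrt_le _ (fun _ => Finset.sum_nonneg fun _ _ => sq_nonneg _)
      fun _ => Finset.sum_nonneg fun _ _ => sq_nonneg _)

/-- Triangle inequality (Minkowski) for `‖·‖_F`. [folklore] -/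
private theorem sqrt_fro_add_le (A B : Matrix (Fin N) (Fin N) ℂ) :
    Real.sqrt (∑ a, ∑ b, ‖(A + B) a b‖ ^ 2) ≤
      Real.sqrt (∑ a, ∑ b, ‖A a b‖ ^ 2) + Real.sqrt (∑ a, ∑ b, ‖B a b‖ ^ 2) := by
  rw [Real.sqrt_le_left (add_nonneg (Real.sqrt_nonneg _) (Real.sqrt_nonneg _))]
  calc ∑ a, ∑ b, ‖(A + B) a b‖ ^ 2
      ≤ ∑ a, ∑ b, (‖A a b‖ ^ 2 + ‖B a b‖ ^ 2 + 2 * (‖A a b‖ * ‖B a b‖)) := by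
        gcongr with a _ b _
        rw [Matrix.add_apply]
        nlinarith [norm_add_le (A a b) (B a b), norm_nonneg (A a b + B a b), norm_nonneg (A a b),
          norm_nonneg (B a b)]
    _ = (∑ a, ∑ b, ‖A a b‖ ^ 2) + (∑ a, ∑ b, ‖B a b‖ ^ 2) +
          2 * ∑ a, ∑ b, ‖A a b‖ * ‖B a b‖ := by
        simp only [Finset.sum_add_distrib, Finset.mul_sum]
    _ ≤ (∑ a, ∑ b, ‖A a b‖ ^ 2) + (∑ a, ∑ b, ‖B a b‖ ^ 2) +
          2 * (Real.sqrt (∑ a, ∑ b, ‖A a b‖ ^ 2) * Real.sqrt (∑ a, ∑ b, ‖B a b‖ ^ 2)) := by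
        gcongr
        exact sum_norm_mul_norm_le A B
    _ = (Real.sqrt (∑ a, ∑ b, ‖A a b‖ ^ 2) + Real.sqrt (∑ a, ∑ b, ‖B a b‖ ^ 2)) ^ 2 := by
        rw [add_sq, Real.sq_sqrt (Finset.sum_nonneg fun _ _ => Finset.sum_nonneg fun _ _ =>
          sq_nonneg _), Real.sq_sqrt (Finset.sum_nonneg fun _ _ => Finset.sum_nonneg fun _ _ =>
          sq_nonneg _)]
        ring

variable {G : Type*} [Group G] (ρ : G →* Matrix (Fin N) (Fin N) ℂ)

/-- `|Re tr ρ x − Re tr ρ x'| ≤ √N ‖ρ x − ρ x'‖_F`. [folklore] -/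
private theorem abs_re_trace_sub_le (x x' : G) :
    |(ρ x).trace.re - (ρ x').trace.re| ≤
      Real.sqrt N * Real.sqrt (∑ a, ∑ b, ‖(ρ x - ρ x') a b‖ ^ 2) := by
  rw [← Complex.sub_re, ← Matrix.trace_sub]
  exact abs_re_trace_le_sqrt _

variable (hρ : ∀ g, ρ g ∈ Matrix.unitaryGroup (Fin N) ℂ)
include hρ

/-- Unitary representations: `‖ρ(x y) − ρ(x' y')‖_F ≤ ‖ρ x − ρ x'‖_F + ‖ρ y − ρ y'‖_F`.
[folklore] -/
private theorem dist_mul_le (x x' y y' : G) :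
    Real.sqrt (∑ a, ∑ b, ‖(ρ (x * y) - ρ (x' * y')) a b‖ ^ 2) ≤
      Real.sqrt (∑ a, ∑ b, ‖(ρ x - ρ x') a b‖ ^ 2) +
        Real.sqrt (∑ a, ∑ b, ‖(ρ y - ρ y') a b‖ ^ 2) := by
  have h : ρ (x * y) - ρ (x' * y') = (ρ x - ρ x') * ρ y + ρ x' * (ρ y - ρ y') := by
    rw [map_mul, map_mul, sub_mul, mul_sub]; abel
  rw [h]
  refine (sqrt_fro_add_le _ _).trans (le_of_eq ?_)
  rw [fro_mul_of_mem_unitaryGroup _ (hρ y), fro_unitary_mul _ (hρ x')]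

/-- Unitary representations: `‖ρ(x⁻¹) − ρ(x'⁻¹)‖_F = ‖ρ x − ρ x'‖_F`. [folklore] -/
private theorem dist_inv_eq (x x' : G) :
    Real.sqrt (∑ a, ∑ b, ‖(ρ x⁻¹ - ρ x'⁻¹) a b‖ ^ 2) =
      Real.sqrt (∑ a, ∑ b, ‖(ρ x - ρ x') a b‖ ^ 2) := by
  have h : ρ x⁻¹ - ρ x'⁻¹ = ρ x⁻¹ * (ρ x' - ρ x) * ρ x'⁻¹ := by
    rw [mul_sub, sub_mul, ← map_mul, ← map_mul, ← map_mul, ← map_mul, mul_inv_cancel_right,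
      inv_mul_cancel, one_mul]
  rw [h, fro_mul_of_mem_unitaryGroup _ (hρ _), fro_unitary_mul _ (hρ _), fro_sub_comm]

/-- The plaquette word `a₁ a₂ a₃⁻¹ a₄⁻¹` is `√N`-Lipschitz in its four unitary factors:
`|Re tr ρ(a₁a₂a₃⁻¹a₄⁻¹) − Re tr ρ(b₁b₂b₃⁻¹b₄⁻¹)| ≤ √N Σₖ ‖ρ aₖ − ρ bₖ‖_F`. [folklore] -/
private theorem abs_re_trace_word_sub_le (a₁ a₂ a₃ a₄ b₁ b₂ b₃ b₄ : G) :
    |(ρ (a₁ * a₂ * a₃⁻¹ * a₄⁻¹)).trace.re - (ρ (b₁ * b₂ * b₃⁻¹ * b₄⁻¹)).trace.re| ≤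
      Real.sqrt N *
        (Real.sqrt (∑ a, ∑ b, ‖(ρ a₁ - ρ b₁) a b‖ ^ 2) +
          Real.sqrt (∑ a, ∑ b, ‖(ρ a₂ - ρ b₂) a b‖ ^ 2) +
          Real.sqrt (∑ a, ∑ b, ‖(ρ a₃ - ρ b₃) a b‖ ^ 2) +
          Real.sqrt (∑ a, ∑ b, ‖(ρ a₄ - ρ b₄) a b‖ ^ 2)) := by
  refine (abs_re_trace_sub_le ρ _ _).trans (mul_le_mul_of_nonneg_left ?_ (Real.sqrt_nonneg _))
  calc Real.sqrt (∑ a, ∑ b, ‖(ρ (a₁ * a₂ * a₃⁻¹ * a₄⁻¹) - ρ (b₁ * b₂ * b₃⁻¹ * b₄⁻¹)) a b‖ ^ 2)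
      ≤ Real.sqrt (∑ a, ∑ b, ‖(ρ (a₁ * a₂ * a₃⁻¹) - ρ (b₁ * b₂ * b₃⁻¹)) a b‖ ^ 2) +
          Real.sqrt (∑ a, ∑ b, ‖(ρ a₄⁻¹ - ρ b₄⁻¹) a b‖ ^ 2) :=
        dist_mul_le ρ hρ _ _ _ _
    _ ≤ Real.sqrt (∑ a, ∑ b, ‖(ρ (a₁ * a₂) - ρ (b₁ * b₂)) a b‖ ^ 2) +
          Real.sqrt (∑ a, ∑ b, ‖(ρ a₃⁻¹ - ρ b₃⁻¹) a b‖ ^ 2) +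
          Real.sqrt (∑ a, ∑ b, ‖(ρ a₄⁻¹ - ρ b₄⁻¹) a b‖ ^ 2) := by
        gcongr; exact dist_mul_le ρ hρ _ _ _ _
    _ ≤ _ := by
        rw [dist_inv_eq ρ hρ, dist_inv_eq ρ hρ]
        gcongr
        exact dist_mul_le ρ hρ _ _ _ _

/-! ### The plaquette word read on a configuration: support, Lipschitz bound, slopes -/

omit hρ in
/-- `U ↦ Re tr ρ(U e₁ U e₂ (U e₃)⁻¹ (U e₄)⁻¹)` reads only the links `e₁, e₂, e₃, e₄`. [folklore] -/
private theorem word_dependsOn {ι : Type*} (P : (ι → G) → ℝ) (e₁ e₂ e₃ e₄ : ι)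
    (hP : ∀ U, P U = (ρ (U e₁ * U e₂ * (U e₃)⁻¹ * (U e₄)⁻¹)).trace.re) :
    DependsOn P ({e₁, e₂, e₃, e₄} : Set ι) := by
  intro U V h
  rw [hP, hP, h e₁ (by simp), h e₂ (by simp), h e₃ (by simp), h e₄ (by simp)]

/-- Link-Lipschitz bound for the plaquette word on four pairwise distinct links:
`|P U − P V| ≤ √N Σ_e ‖ρ (U e) − ρ (V e)‖_F`. [folklore] -/
private theorem word_lipschitz {ι : Type*} [Fintype ι] (P : (ι → G) → ℝ) (e₁ e₂ e₃ e₄ : ι)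
    (h12 : e₁ ≠ e₂) (h13 : e₁ ≠ e₃) (h14 : e₁ ≠ e₄) (h23 : e₂ ≠ e₃) (h24 : e₂ ≠ e₄)
    (h34 : e₃ ≠ e₄) (hP : ∀ U, P U = (ρ (U e₁ * U e₂ * (U e₃)⁻¹ * (U e₄)⁻¹)).trace.re)
    (U V : ι → G) :
    |P U - P V| ≤ Real.sqrt N * ∑ e, Real.sqrt (∑ a, ∑ b, ‖(ρ (U e) - ρ (V e)) a b‖ ^ 2) := by
  classical
  rw [hP, hP]
  refine (abs_re_trace_word_sub_le ρ hρ _ _ _ _ _ _ _ _).trans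
    (mul_le_mul_of_nonneg_left ?_ (Real.sqrt_nonneg _))
  have hsum : Real.sqrt (∑ a, ∑ b, ‖(ρ (U e₁) - ρ (V e₁)) a b‖ ^ 2) +
      Real.sqrt (∑ a, ∑ b, ‖(ρ (U e₂) - ρ (V e₂)) a b‖ ^ 2) +
      Real.sqrt (∑ a, ∑ b, ‖(ρ (U e₃) - ρ (V e₃)) a b‖ ^ 2) +
      Real.sqrt (∑ a, ∑ b, ‖(ρ (U e₄) - ρ (V e₄)) a b‖ ^ 2) =
      ∑ e ∈ ({e₁, e₂, e₃, e₄} : Finset ι),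
        Real.sqrt (∑ a, ∑ b, ‖(ρ (U e) - ρ (V e)) a b‖ ^ 2) := by
    rw [Finset.sum_insert (by simp [h12, h13, h14]), Finset.sum_insert (by simp [h23, h24]),
      Finset.sum_pair h34]
    ring
  rw [hsum]
  exact Finset.sum_le_univ_sum_of_nonneg fun e => Real.sqrt_nonneg _

/-- One-link version: the metric difference quotient of the plaquette word is `≤ √N`
(junk value `0 ≤ √N` where the denominator vanishes). [folklore] -/
private theorem word_quotient_le {ι : Type*} [Fintype ι] [DecidableEq ι] (P : (ι → G) → ℝ)
    (e₁ e₂ e₃ e₄ : ι) (h12 : e₁ ≠ e₂) (h13 : e₁ ≠ e₃) (h14 : e₁ ≠ e₄) (h23 : e₂ ≠ e₃)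
    (h24 : e₂ ≠ e₄) (h34 : e₃ ≠ e₄)
    (hP : ∀ U, P U = (ρ (U e₁ * U e₂ * (U e₃)⁻¹ * (U e₄)⁻¹)).trace.re) (U : ι → G) (e : ι)
    (g : G) :
    |P (Function.update U e g) - P U| / Real.sqrt (∑ a, ∑ b, ‖(ρ g - ρ (U e)) a b‖ ^ 2) ≤
      Real.sqrt N := by
  have hsum : ∑ e', Real.sqrt (∑ a, ∑ b, ‖(ρ (Function.update U e g e') - ρ (U e')) a b‖ ^ 2) =
      Real.sqrt (∑ a, ∑ b, ‖(ρ g - ρ (U e)) a b‖ ^ 2) := by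
    rw [Finset.sum_eq_single e]
    · rw [Function.update_self]
    · intro e' _ hne; simp [Function.update_of_ne hne]
    · exact fun h => absurd (Finset.mem_univ e) h
  have hnum : |P (Function.update U e g) - P U| ≤
      Real.sqrt N * Real.sqrt (∑ a, ∑ b, ‖(ρ g - ρ (U e)) a b‖ ^ 2) := by
    rw [← hsum]
    exact word_lipschitz ρ hρ P e₁ e₂ e₃ e₄ h12 h13 h14 h23 h24 h34 hP _ _
  rcases (Real.sqrt_nonneg (∑ a, ∑ b, ‖(ρ g - ρ (U e)) a b‖ ^ 2)).eq_or_lt with h0 | hpos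
  · rw [← h0, div_zero]; exact Real.sqrt_nonneg _
  · rwa [div_le_iff₀ hpos]

omit hρ in
/-- `limsup` of the zero function is `0` along every filter (also along `⊥`). [folklore] -/
private theorem limsup_zero {α : Type*} (F : Filter α) :
    Filter.limsup (fun _ : α => (0 : ℝ)) F = 0 := by
  by_cases h : F.NeBot
  · exact Filter.limsup_const 0
  · rw [Filter.not_neBot] at h; simp [h, Filter.limsup, Filter.limsSup]

omit hρ in
/-- A function with values in `[0, C]` has `limsup² ≤ C²` along every filter (the `limsup` along
`⊥` is the junk value `0`). [folklore] -/
private theorem limsup_sq_le {α : Type*} (F : Filter α) {q : α → ℝ} {C : ℝ} (hC : 0 ≤ C)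
    (h0 : ∀ x, 0 ≤ q x) (hq : ∀ x, q x ≤ C) : (Filter.limsup q F) ^ 2 ≤ C ^ 2 := by
  by_cases hF : F.NeBot
  · have h1 : Filter.limsup q F ≤ C :=
      Filter.limsup_le_of_le (Filter.isCoboundedUnder_le_of_le F h0) (Eventually.of_forall hq)
    have h2 : 0 ≤ Filter.limsup q F :=
      Filter.le_limsup_of_le (Filter.isBoundedUnder_of ⟨C, hq⟩) fun b hb => by
        obtain ⟨x, hx⟩ := hb.exists
        exact (h0 x).trans hx
    exact pow_le_pow_left₀ h2 h1 2
  · rw [Filter.not_neBot] at hF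
    rw [show Filter.limsup q F = 0 by simp [hF, Filter.limsup, Filter.limsSup]]
    exact pow_le_pow_left₀ le_rfl hC 2

/-- Dirichlet-form bookkeeping for the plaquette word under a probability measure: the squared
metric slope integrates to `≤ N` on each of the four links and to `0` on every other link, so any
sub-sum of links is `≤ 4N`. [folklore] -/
private theorem word_dirichlet_le {ι : Type*} [Fintype ι] [DecidableEq ι] [TopologicalSpace G]
    [MeasurableSpace G] (p : ι → Prop) [DecidablePred p] (P : (ι → G) → ℝ) (e₁ e₂ e₃ e₄ : ι)
    (h12 : e₁ ≠ e₂) (h13 : e₁ ≠ e₃) (h14 : e₁ ≠ e₄) (h23 : e₂ ≠ e₃) (h24 : e₂ ≠ e₄)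
    (h34 : e₃ ≠ e₄) (hP : ∀ U, P U = (ρ (U e₁ * U e₂ * (U e₃)⁻¹ * (U e₄)⁻¹)).trace.re)
    (μ : Measure (ι → G)) (hμ : IsProbabilityMeasure μ) :
    ∑ e, (if p e then
      ∫ U, (Filter.limsup (fun g : G => |P (Function.update U e g) - P U| /
        Real.sqrt (∑ a, ∑ b, ‖(ρ g - ρ (U e)) a b‖ ^ 2)) (𝓝[≠] (U e))) ^ 2 ∂μ else 0) ≤
      4 * N := by
  have hterm : ∀ e, (if p e then
      ∫ U, (Filter.limsup (fun g : G => |P (Function.update U e g) - P U| /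
        Real.sqrt (∑ a, ∑ b, ‖(ρ g - ρ (U e)) a b‖ ^ 2)) (𝓝[≠] (U e))) ^ 2 ∂μ else 0) ≤
      if e ∈ ({e₁, e₂, e₃, e₄} : Finset ι) then (N : ℝ) else 0 := by
    intro e
    split_ifs with hp he
    · refine (integral_mono_of_nonneg (ae_of_all _ fun U => sq_nonneg _)
        (integrable_const (N : ℝ)) (ae_of_all _ fun U => ?_)).trans_eq (by simp)
      calc _ ≤ Real.sqrt N ^ 2 :=
            limsup_sq_le _ (Real.sqrt_nonneg _)
              (fun g => div_nonneg (abs_nonneg _) (Real.sqrt_nonneg _))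
              fun g => word_quotient_le ρ hρ P e₁ e₂ e₃ e₄ h12 h13 h14 h23 h24 h34 hP U e g
        _ = N := Real.sq_sqrt (Nat.cast_nonneg _)
    · have h0 : ∀ U : ι → G, (fun g : G => |P (Function.update U e g) - P U| /
          Real.sqrt (∑ a, ∑ b, ‖(ρ g - ρ (U e)) a b‖ ^ 2)) = fun _ => 0 := by
        intro U
        funext g
        have hPU : P (Function.update U e g) = P U :=
          word_dependsOn ρ P e₁ e₂ e₃ e₄ hP fun i hi => by
            rw [Function.update_of_ne]; rintro rfl; exact he (by simpa using hi)
        rw [hPU, sub_self, abs_zero, zero_div]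
      simp only [h0, limsup_zero]
      simp
    · exact Nat.cast_nonneg _
    · exact le_rfl
  calc _ ≤ ∑ e, (if e ∈ ({e₁, e₂, e₃, e₄} : Finset ι) then (N : ℝ) else 0) :=
        Finset.sum_le_sum fun e _ => hterm e
    _ = ({e₁, e₂, e₃, e₄} : Finset ι).card * N := by
        rw [Finset.sum_ite_mem, Finset.univ_inter, Finset.sum_const, nsmul_eq_mul]
    _ ≤ 4 * N := by
        gcongr
        exact_mod_cast Finset.card_le_four

end Frobenius

/-! ### The four links of the `(2,3)`-plaquette at the origin -/

/-- Gauge covariance of the torus plaquette holonomy: `(U^g)_p = g(x) U_p g(x)⁻¹`. [folklore] -/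
private theorem plaquetteHolonomy_gaugeTransform {d L : ℕ} {G : Type*} [Group G]
    (g : Site d L → G) (U : GaugeConfig d L G) (x : Site d L) (i j : Fin d) :
    plaquetteHolonomy (gaugeTransform g U) x i j = g x * plaquetteHolonomy U x i j * (g x)⁻¹ := by
  have hshift : (x.shift j).shift i = (x.shift i).shift j := by
    simp only [Site.shift, add_assoc, add_comm (Pi.single (M := fun _ => ZMod L) i 1)]
  simp only [plaquetteHolonomy, gaugeTransform, hshift, mul_inv_rev, inv_inv]
  group

/-- Off its own direction the shifted origin has coordinate `0`: `(0 + eᵢ) j = 0` for `j ≠ i`.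
[folklore] -/
private theorem shift_zero_apply_of_ne {L : ℕ} (i j : Fin 4) (h : j ≠ i) :
    (0 : Site 4 L).shift i j = 0 := by
  simp [Site.shift, Pi.single_eq_of_ne h]

/-- On a torus of side `> 1` the shifted origin is not the origin. [folklore] -/
private theorem shift_zero_ne_zero {L : ℕ} [Fact (1 < L)] (i : Fin 4) :
    (0 : Site 4 L).shift i ≠ 0 := fun h => by
  simpa [Site.shift] using congrFun h i

/-- G3 `stub_plaquette_admissible`: on the torus `(2S+1)⁴`, `S ≥ 1`, the torus reading
`P U = plaquetteObs r.ρ 0 2 3 (torusLift (2S+1) U) = Re tr r.ρ(U(0,2) U(e₂,3) U(e₃,2)⁻¹ U(0,3)⁻¹)`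
of the `(2,3)`-plaquette species is gauge invariant, reads only the layer
`{t = 0, x₁ = 0, directions 2, 3}`, is link-Lipschitz with constant `√N`, and has time-zero
Dirichlet form `≤ 4N` under every probability measure. [folklore] -/
theorem stub_plaquette_admissible :
    ∀ (G : Type) [Group G] [TopologicalSpace G] [IsTopologicalGroup G] [CompactSpace G]
      [MeasurableSpace G] [BorelSpace G] (r : LatticeRep G) (S : ℕ), 1 ≤ S →
    IsGaugeInvariant (fun U : GaugeConfig 4 (2 * S + 1) G =>
        plaquetteObs r.ρ 0 2 3 (torusLift (2 * S + 1) U)) ∧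
    DependsOn (fun U : GaugeConfig 4 (2 * S + 1) G => plaquetteObs r.ρ 0 2 3 (torusLift (2 * S + 1) U))
      {e : Edge 4 (2 * S + 1) | e.1 0 = 0 ∧ e.1 1 = 0 ∧ e.2 ≠ 0 ∧ e.2 ≠ 1} ∧
    (∀ U V : GaugeConfig 4 (2 * S + 1) G,
      |plaquetteObs r.ρ 0 2 3 (torusLift (2 * S + 1) U) - plaquetteObs r.ρ 0 2 3 (torusLift (2 * S + 1) V)| ≤
        Real.sqrt r.N * ∑ e, Real.sqrt (∑ a, ∑ b, ‖(r.ρ (U e) - r.ρ (V e)) a b‖ ^ 2)) ∧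
    (∀ μ : Measure (GaugeConfig 4 (2 * S + 1) G), IsProbabilityMeasure μ →
      ∑ e : Edge 4 (2 * S + 1), (if e.1 0 = 0 ∧ e.2 ≠ 0 then
        ∫ U, (Filter.limsup (fun g : G =>
            |plaquetteObs r.ρ 0 2 3 (torusLift (2 * S + 1) (Function.update U e g)) -
                plaquetteObs r.ρ 0 2 3 (torusLift (2 * S + 1) U)| /
              Real.sqrt (∑ a, ∑ b, ‖(r.ρ g - r.ρ (U e)) a b‖ ^ 2)) (𝓝[≠] (U e))) ^ 2 ∂μ else 0) ≤
        4 * r.N) := by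
  intro G _ _ _ _ _ _ r S hS
  haveI : Fact (1 < 2 * S + 1) := ⟨by omega⟩
  -- the bridge to the torus plaquette holonomy
  have hproj : Literature.Probability.LatticeModels.Torus.proj (2 * S + 1) (0 : Fin 4 → ℤ) =
      (0 : Site 4 (2 * S + 1)) := funext fun i => by simp
  have hP : ∀ U : GaugeConfig 4 (2 * S + 1) G, plaquetteObs r.ρ 0 2 3 (torusLift (2 * S + 1) U) =
      (r.ρ (plaquetteHolonomy U 0 2 3)).trace.re := by
    intro U
    rw [plaquetteObs, FreeEnergy.plaquetteHolonomyZd_torusLift, hproj]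
  -- the same, as an explicit word in the four plaquette links
  have hP' : ∀ U : GaugeConfig 4 (2 * S + 1) G, plaquetteObs r.ρ 0 2 3 (torusLift (2 * S + 1) U) =
      (r.ρ (U ((0 : Site 4 (2 * S + 1)), 2) * U ((0 : Site 4 (2 * S + 1)).shift 2, 3) *
        (U ((0 : Site 4 (2 * S + 1)).shift 3, 2))⁻¹ * (U ((0 : Site 4 (2 * S + 1)), 3))⁻¹)).trace.re :=
    hP
  -- the four links are pairwise distinct (`2S+1 > 1`)
  have h12 : (((0 : Site 4 (2 * S + 1)), (2 : Fin 4)) : Edge 4 (2 * S + 1)) ≠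
      ((0 : Site 4 (2 * S + 1)).shift 2, 3) :=
    fun h => (by decide : (2 : Fin 4) ≠ 3) (congrArg Prod.snd h)
  have h13 : (((0 : Site 4 (2 * S + 1)), (2 : Fin 4)) : Edge 4 (2 * S + 1)) ≠
      ((0 : Site 4 (2 * S + 1)).shift 3, 2) :=
    fun h => shift_zero_ne_zero 3 (congrArg Prod.fst h).symm
  have h14 : (((0 : Site 4 (2 * S + 1)), (2 : Fin 4)) : Edge 4 (2 * S + 1)) ≠ (0, 3) :=
    fun h => (by decide : (2 : Fin 4) ≠ 3) (congrArg Prod.snd h)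
  have h23 : (((0 : Site 4 (2 * S + 1)).shift 2, (3 : Fin 4)) : Edge 4 (2 * S + 1)) ≠
      ((0 : Site 4 (2 * S + 1)).shift 3, 2) :=
    fun h => (by decide : (3 : Fin 4) ≠ 2) (congrArg Prod.snd h)
  have h24 : (((0 : Site 4 (2 * S + 1)).shift 2, (3 : Fin 4)) : Edge 4 (2 * S + 1)) ≠ (0, 3) :=
    fun h => shift_zero_ne_zero 2 (congrArg Prod.fst h)
  have h34 : (((0 : Site 4 (2 * S + 1)).shift 3, (2 : Fin 4)) : Edge 4 (2 * S + 1)) ≠ (0, 3) :=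
    fun h => (by decide : (2 : Fin 4) ≠ 3) (congrArg Prod.snd h)
  refine ⟨fun g U => ?_, ?_, fun U V => ?_, fun μ hμ => ?_⟩
  · -- (a) gauge invariance: conjugation at the base point and cyclicity of the trace
    simp only [hP, plaquetteHolonomy_gaugeTransform]
    rw [map_mul, map_mul, Matrix.trace_mul_cycle, ← map_mul, inv_mul_cancel, map_one, one_mul]
  · -- (b) the four links lie in the layer
    refine (word_dependsOn r.ρ _ _ _ _ _ hP').mono ?_
    intro e he
    simp only [Set.mem_insert_iff, Set.mem_singleton_iff] at he
    rcases he with rfl | rfl | rfl | rfl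
    · exact ⟨rfl, rfl, (by decide : (2 : Fin 4) ≠ 0), (by decide : (2 : Fin 4) ≠ 1)⟩
    · exact ⟨shift_zero_apply_of_ne 2 0 (by decide), shift_zero_apply_of_ne 2 1 (by decide),
        (by decide : (3 : Fin 4) ≠ 0), (by decide : (3 : Fin 4) ≠ 1)⟩
    · exact ⟨shift_zero_apply_of_ne 3 0 (by decide), shift_zero_apply_of_ne 3 1 (by decide),
        (by decide : (2 : Fin 4) ≠ 0), (by decide : (2 : Fin 4) ≠ 1)⟩
    · exact ⟨rfl, rfl, (by decide : (3 : Fin 4) ≠ 0), (by decide : (3 : Fin 4) ≠ 1)⟩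
  · -- (c) link-Lipschitz with constant `√N`
    exact word_lipschitz r.ρ r.mem_unitary _ _ _ _ _ h12 h13 h14 h23 h24 h34 hP' U V
  · -- (d) time-zero Dirichlet form `≤ 4N`
    exact word_dirichlet_le r.ρ r.mem_unitary (fun e : Edge 4 (2 * S + 1) => e.1 0 = 0 ∧ e.2 ≠ 0)
      _ _ _ _ _ h12 h13 h14 h23 h24 h34 hP' μ hμ

end Summit.QuantumFields.YangMills.Theorems.PoincareToGap

end
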